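import Mathlib
import Literature.MathematicalPhysics.QuantumLattice.WilsonDiracAP
import Summits.QuantumFields.QCD.Theorems.QuarksAsStableActionCriticalLineDiamagnetismStubWardKernel
import Summits.QuantumFields.QCD.Theorems.WilsonQuarkChessboardFlatCellOptimalStubTadpoleAllN

/-!
# The blockwise polarised Ward identity for the one-loop block Hessian, `N` colours
(helper for crux stmt-QuantumFields-9307 `FlatCellOptimal`, line `registered`, stub
`stub_hessianMarginAllN`, sub-goal `stub_wardKernelAllN` — the `Fin 3 ↦ Fin N` port of the sibling
crux stmt-QuantumFields-9734's `…CriticalLineDiamagnetismStubWardKernel`, gap G2a, wave 6)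

What.  On the `2⁴` block `(ℤ/2)⁴` (colour `Fin N`, ANY `N : ℕ`, spin `Fin 4`) with constant central
link phases `u_μ = e^{iθ_μ}·1 ∈ U(N)`, let `B⁰` be the free `r = 1` Wilson–Dirac operator, `Δ(E)` the
hopping perturbation (ℝ-linear in the matrix-valued link field `E : Edge 4 2 → M_N(ℂ)`),
`ℓ(E) = Re tr (B⁰⁻¹ Δ(E))` the tadpole and `𝔅(E₁, E₂) = Re tr (B⁰⁻¹ Δ(E₁) B⁰⁻¹ Δ(E₂))` the bubble.
For every anti-Hermitian link field `Y` and every anti-Hermitian site function `λ` (not assumed to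
commute with anything), with the gauge mode `dλ(x,μ) = λ(x) − λ(x+μ̂)`:
`𝔅(Y, dλ) = ½ ℓ(Y⋆dλ + dλ⋆Y)` (`⋆` the linkwise matrix product) (`stub_wardKernelAllN`; the
sibling's `stub_wardKernel` is the case `N = 3`).  This is the polarised form of the gauge
invariance of the block determinant: gauge modes lie in the kernel of the block Hessian
`Q(Y) = ½𝔅(Y,Y) − ½ℓ(Y⋆Y)`.  The statement is the sibling's with `Fin 3 ↦ Fin N` and with the
`let`s `B0`, `Dl` turned into universally quantified variables with defining equations (`ell`, `bf`
inlined), so that the registered signature contains no `:=`; it is exactly the hypothesis `hward` of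
the block reduction.

How (exact matrix algebra, no Fourier analysis; verbatim the sibling's argument with `Fin 3 ↦ Fin N`).
* With the hopping form `H(C⁺, C⁻)` of `…StubTadpoleAuxAllN` one has `Δ(E) = H(uE, (uE)ᴴ)` and
  `B⁰ = (m + 4)·1 + H(u, ū)`.  For the block-diagonal colour multiplier `Λ = ⊕_x λ(x) ⊗ 1_spin`
  the products `Λ H(C⁺, C⁻)` and `H(C⁺, C⁻) Λ` are again hopping forms (`blockDiag_mul_hop`,
  `hop_mul_blockDiag`), whence the commutator formula
  `[Λ, H(C⁺, C⁻)] = H(λC⁺ − C⁺λ(·+μ̂), λ(·+μ̂)C⁻ − C⁻λ)` (`comm_hop`).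
* Consequently `Δ(dλ) = [Λ, B⁰]` (the phases are central) and `[Λ, Δ(Y)] = Δ(Z)` with
  `Z(x,μ) = λ(x)Y(x,μ) − Y(x,μ)λ(x+μ̂)` (`Yᴴ = −Y`, `λᴴ = −λ`).
* Cyclicity of the trace gives `tr (B⁻¹ D B⁻¹ [Λ, B]) = tr (B⁻¹ [Λ, D])` for the nonsingular inverse
  (the colour-free `trace_bubble_comm` of the sibling file, re-EXPORTED here as an alias), so
  `𝔅(Y, dλ) = ℓ(Z)`.
* `2Z − (Y⋆dλ + dλ⋆Y)` is the field of commutators `[λ(x) + λ(x+μ̂), Y(x,μ)]`, whose colour traces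
  vanish linkwise; `ℓ` of it is `0` by the all-`N` tadpole theorem `stub_tadpoleAllN`, and `ℓ` is
  ℝ-linear.

Sources: Montvay–Münster, *Quantum Fields on a Lattice* §4.2 (Wilson fermions, hopping expansion,
gauge invariance of the fermion determinant); folklore linear algebra. Pure theorem file (no `def`s).
-/

noncomputable section

open scoped BigOperators Classical Matrix ComplexConjugate
open Finset
open Literature.MathematicalPhysics.QuantumLattice Literature.MathematicalPhysics.QuantumFieldTheory
  Literature.Probability.LatticeModels

namespace Summit.QuantumFields.QCD.Cruxes.FlatCellOptimal.WardKernel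

open Complex (I)

/-! ### The colour-free lemma of the sibling file, re-exported under the same name (alias) -/

export Summit.QuantumFields.QCD.Cruxes.CriticalLineDiamagnetism.ChessboardCellGain.WardKernel
  (trace_bubble_comm)

/-! ### Collapsing sums against the block-diagonal colour multiplier (`N` colours) -/

/-- `Σ_r [x = r.1 ∧ α = r.2.2] F r = Σ_b F (x, b, α)` (colour index `Fin N`). -/
theorem sum_ite_eq_left {N : ℕ} (x : TorusSite 4 2) (α : Fin 4) (F : TorusSite 4 2 × Fin N × Fin 4 → ℂ) :
    (∑ r : TorusSite 4 2 × Fin N × Fin 4, if x = r.1 ∧ α = r.2.2 then F r else 0) =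
      ∑ b : Fin N, F (x, b, α) := by
  -- adapted from the sibling's `WardKernel.sum_ite_eq_left` (`Fin 3 ↦ Fin N`)
  rw [Fintype.sum_prod_type, Finset.sum_eq_single x]
  · rw [Fintype.sum_prod_type]
    refine Finset.sum_congr rfl fun b _ => ?_
    simp only [true_and, Finset.sum_ite_eq, Finset.mem_univ, if_true]
  · intro y _ hy
    simp [Ne.symm hy]
  · simp

/-- `Σ_r [r.1 = x ∧ r.2.2 = α] F r = Σ_b F (x, b, α)` (colour index `Fin N`). -/
theorem sum_ite_eq_right {N : ℕ} (x : TorusSite 4 2) (α : Fin 4) (F : TorusSite 4 2 × Fin N × Fin 4 → ℂ) :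
    (∑ r : TorusSite 4 2 × Fin N × Fin 4, if r.1 = x ∧ r.2.2 = α then F r else 0) =
      ∑ b : Fin N, F (x, b, α) := by
  -- adapted from the sibling's `WardKernel.sum_ite_eq_right` (`Fin 3 ↦ Fin N`)
  rw [Fintype.sum_prod_type, Finset.sum_eq_single x]
  · rw [Fintype.sum_prod_type]
    refine Finset.sum_congr rfl fun b _ => ?_
    simp only [true_and, Finset.sum_ite_eq', Finset.mem_univ, if_true]
  · intro y _ hy
    simp [hy]
  · simp

/-! ### The block-diagonal colour multiplier and the hopping form (`N` colours) -/

section Hop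

variable {N : ℕ} {H : (Fin 4 → TorusSite 4 2 → Matrix (Fin N) (Fin N) ℂ) →
    (Fin 4 → TorusSite 4 2 → Matrix (Fin N) (Fin N) ℂ) →
      Matrix (TorusSite 4 2 × Fin N × Fin 4) (TorusSite 4 2 × Fin N × Fin 4) ℂ}
  {Λ : Matrix (TorusSite 4 2 × Fin N × Fin 4) (TorusSite 4 2 × Fin N × Fin 4) ℂ}
  {lam : TorusSite 4 2 → Matrix (Fin N) (Fin N) ℂ}

variable (hH : ∀ Cp Cm, H Cp Cm = Matrix.of fun p q : TorusSite 4 2 × Fin N × Fin 4 =>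
    -(1 / 2 : ℂ) * ∑ μ : Fin 4,
      ((if q.1 = Site.shift p.1 μ then
          ((1 : Matrix (Fin 4) (Fin 4) ℂ) - euclideanGamma μ) p.2.2 q.2.2 * Cp μ p.1 p.2.1 q.2.1
        else 0) +
        (if p.1 = Site.shift q.1 μ then
          ((1 : Matrix (Fin 4) (Fin 4) ℂ) + euclideanGamma μ) p.2.2 q.2.2 * Cm μ q.1 p.2.1 q.2.1
        else 0)))
include hH

/-- The hopping form is subtractive in its blocks (`N` colours). -/
theorem hop_sub (Cp Cm Cp' Cm' : Fin 4 → TorusSite 4 2 → Matrix (Fin N) (Fin N) ℂ) :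
    H Cp Cm - H Cp' Cm' = H (Cp - Cp') (Cm - Cm') := by
  rw [sub_eq_iff_eq_add, ← Tadpole.hop_add hH, sub_add_cancel, sub_add_cancel]

variable (hΛ : Λ = Matrix.of fun p q : TorusSite 4 2 × Fin N × Fin 4 =>
    if p.1 = q.1 ∧ p.2.2 = q.2.2 then lam p.1 p.2.1 q.2.1 else 0)
include hΛ

/-- **Left multiplication by the colour multiplier** `Λ = ⊕_x λ(x) ⊗ 1` (`N` colours):
`Λ H(C⁺, C⁻) = H(λC⁺, λ(·+μ̂)C⁻)`. -/
theorem blockDiag_mul_hop (Cp Cm : Fin 4 → TorusSite 4 2 → Matrix (Fin N) (Fin N) ℂ) :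
    Λ * H Cp Cm = H (fun μ x => lam x * Cp μ x) (fun μ y => lam (Site.shift y μ) * Cm μ y) := by
  -- adapted from the sibling's `WardKernel.blockDiag_mul_hop` (`Fin 3 ↦ Fin N`)
  ext ⟨x, a, α⟩ ⟨y, b, β⟩
  rw [hΛ, hH, hH, Matrix.mul_apply]
  simp only [Matrix.of_apply, ite_mul, zero_mul]
  rw [sum_ite_eq_left]
  simp only [Matrix.mul_apply, Finset.mul_sum]
  rw [Finset.sum_comm]
  refine Finset.sum_congr rfl fun μ _ => ?_
  split_ifs with hP hQ hQ
  · subst hQ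
    rw [← Finset.sum_add_distrib, Finset.mul_sum]
    exact Finset.sum_congr rfl fun b' _ => by ring
  · simp only [add_zero, Finset.mul_sum]
    exact Finset.sum_congr rfl fun b' _ => by ring
  · subst hQ
    simp only [zero_add, Finset.mul_sum]
    exact Finset.sum_congr rfl fun b' _ => by ring
  · simp

/-- **Right multiplication by the colour multiplier** (`N` colours): `H(C⁺, C⁻) Λ = H(C⁺λ(·+μ̂), C⁻λ)`. -/
theorem hop_mul_blockDiag (Cp Cm : Fin 4 → TorusSite 4 2 → Matrix (Fin N) (Fin N) ℂ) :
    H Cp Cm * Λ = H (fun μ x => Cp μ x * lam (Site.shift x μ)) (fun μ y => Cm μ y * lam y) := by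
  -- adapted from the sibling's `WardKernel.hop_mul_blockDiag` (`Fin 3 ↦ Fin N`)
  ext ⟨x, a, α⟩ ⟨y, b, β⟩
  rw [hΛ, hH, hH, Matrix.mul_apply]
  simp only [Matrix.of_apply, mul_ite, mul_zero]
  rw [sum_ite_eq_right]
  simp only [Matrix.mul_apply, Finset.mul_sum, Finset.sum_mul]
  rw [Finset.sum_comm]
  refine Finset.sum_congr rfl fun μ _ => ?_
  split_ifs with hP hQ hQ
  · subst hP
    rw [← Finset.sum_add_distrib, Finset.mul_sum]
    exact Finset.sum_congr rfl fun b' _ => by ring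
  · subst hP
    simp only [add_zero, Finset.mul_sum]
    exact Finset.sum_congr rfl fun b' _ => by ring
  · simp only [zero_add, Finset.mul_sum]
    exact Finset.sum_congr rfl fun b' _ => by ring
  · simp

/-- **Commutator with the colour multiplier** (`N` colours):
`[Λ, H(C⁺, C⁻)] = H(λC⁺ − C⁺λ(·+μ̂), λ(·+μ̂)C⁻ − C⁻λ)`. -/
theorem comm_hop (Cp Cm : Fin 4 → TorusSite 4 2 → Matrix (Fin N) (Fin N) ℂ) :
    Λ * H Cp Cm - H Cp Cm * Λ =
      H (fun μ x => lam x * Cp μ x - Cp μ x * lam (Site.shift x μ))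
        (fun μ y => lam (Site.shift y μ) * Cm μ y - Cm μ y * lam y) := by
  rw [blockDiag_mul_hop hH hΛ, hop_mul_blockDiag hH hΛ, hop_sub hH]
  rfl

end Hop

open Tadpole Complex in
open Summit.QuantumFields.QCD.Cruxes.FlatCellOptimal.FreeTwistedFourier (star_exp_smul_one) in
/-- **Sub-goal `stub_wardKernelAllN` — the blockwise polarised Ward identity for `N` colours.**  On the
`2⁴` block with constant central phases `u_μ = e^{iθ_μ}·1 ∈ U(N)`, for every anti-Hermitian link field
`Y` and every anti-Hermitian site function `λ`, with `dλ(x,μ) = λ(x) − λ(x+μ̂)`: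
`Re tr (B⁰⁻¹ Δ(Y) B⁰⁻¹ Δ(dλ)) = ½ Re tr (B⁰⁻¹ Δ(Y⋆dλ + dλ⋆Y))` (`B⁰ = B0`, `Δ = Dl` given by their
defining equations).  Proof: `Δ(dλ) = [Λ, B⁰]` and `[Λ, Δ(Y)] = Δ(Z)`, `Z(x,μ) = λ(x)Y(x,μ) − Y(x,μ)λ(x+μ̂)`,
`Λ = ⊕_x λ(x) ⊗ 1_spin` (`comm_hop`); hence the bubble is `Re tr (B⁰⁻¹[Λ, Δ(Y)]) = ℓ(Z)` by cyclicity
(`trace_bubble_comm`), and `2Z − (Y⋆dλ + dλ⋆Y)` is a field of commutators, killed by `ℓ`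
(`stub_tadpoleAllN` and ℝ-linearity). -/
theorem stub_wardKernelAllN : ∀ (N : ℕ) (m : ℝ) (θ : Fin 4 → ℝ) (u : Fin 4 → Matrix.unitaryGroup (Fin N) ℂ), (∀ μ, ((u μ : Matrix.unitaryGroup (Fin N) ℂ) : Matrix (Fin N) (Fin N) ℂ) = Complex.exp (↑(θ μ) * Complex.I) • (1 : Matrix (Fin N) (Fin N) ℂ)) → ∀ (B0 : Matrix (TorusSite 4 2 × Fin N × Fin 4) (TorusSite 4 2 × Fin N × Fin 4) ℂ) (Dl : (Edge 4 2 → Matrix (Fin N) (Fin N) ℂ) → Matrix (TorusSite 4 2 × Fin N × Fin 4) (TorusSite 4 2 × Fin N × Fin 4) ℂ), B0 = wilsonDirac (unitaryFundamentalRep (Fin N) ℂ) (fun e : Edge 4 2 => u e.2) m 1 → (∀ E, Dl E = Matrix.of fun (p q : TorusSite 4 2 × Fin N × Fin 4) => -(1 / 2 : ℂ) * ∑ μ : Fin 4, ((if q.1 = Site.shift p.1 μ then ((1 : Matrix (Fin 4) (Fin 4) ℂ) - euclideanGamma μ) p.2.2 q.2.2 * (((u μ : Matrix.unitaryGroup (Fin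 N) ℂ) : Matrix (Fin N) (Fin N) ℂ) * E (p.1, μ)) p.2.1 q.2.1 else 0) + (if p.1 = Site.shift q.1 μ then ((1 : Matrix (Fin 4) (Fin 4) ℂ) + euclideanGamma μ) p.2.2 q.2.2 * (((u μ : Matrix.unitaryGroup (Fin N) ℂ) : Matrix (Fin N) (Fin N) ℂ) * E (q.1, μ))ᴴ p.2.1 q.2.1 else 0))) → ∀ (Y : Edge 4 2 → Matrix (Fin N) (Fin N) ℂ) (lam : TorusSite 4 2 → Matrix (Fin N) (Fin N) ℂ), (∀ e, (Y e)ᴴ = -Y e) → (∀ x, (lam x)ᴴ = -lam x) → (B0⁻¹ * Dl Y * (B0⁻¹ * Dl (fun e => lam e.1 - lam (Site.shift e.1 e.2)))).trace.re = (B0⁻¹ * Dl (fun e => Y e * (lam e.1 - lam (Site.shift e.1 e.2)) + (lam e.1 - lam (Site.shift e.1 e.2)) * Y e)).trace.re / 2 := by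
  -- adapted from the sibling's `stub_wardKernel` (`Fin 3 ↦ Fin N`, `1/3 ↦ 1/N`, `let`s ↦ equations)
  intro N m θ u hu B0 Dl hB0def hDldef Y lam hY hlam
  -- the functional `ℓ(E) = Re tr (B⁰⁻¹ Δ(E))`
  obtain ⟨ell, hell⟩ : ∃ ell : (Edge 4 2 → Matrix (Fin N) (Fin N) ℂ) → ℝ,
      ∀ E', ell E' = (B0⁻¹ * Dl E').trace.re := ⟨_, fun _ => rfl⟩
  -- the hopping form `H`: `Δ(E) = H(uE, (uE)ᴴ)`, `B⁰ = (m + 4)·1 + H(u, ū)`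
  obtain ⟨H, hH⟩ : ∃ H : (Fin 4 → TorusSite 4 2 → Matrix (Fin N) (Fin N) ℂ) →
      (Fin 4 → TorusSite 4 2 → Matrix (Fin N) (Fin N) ℂ) →
        Matrix (TorusSite 4 2 × Fin N × Fin 4) (TorusSite 4 2 × Fin N × Fin 4) ℂ,
      ∀ Cp Cm, H Cp Cm = Matrix.of fun p q : TorusSite 4 2 × Fin N × Fin 4 =>
        -(1 / 2 : ℂ) * ∑ μ : Fin 4,
          ((if q.1 = Literature.MathematicalPhysics.QuantumFieldTheory.Site.shift p.1 μ then
              ((1 : Matrix (Fin 4) (Fin 4) ℂ) - euclideanGamma μ) p.2.2 q.2.2 * Cp μ p.1 p.2.1 q.2.1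
            else 0) +
            (if p.1 = Literature.MathematicalPhysics.QuantumFieldTheory.Site.shift q.1 μ then
              ((1 : Matrix (Fin 4) (Fin 4) ℂ) + euclideanGamma μ) p.2.2 q.2.2 * Cm μ q.1 p.2.1 q.2.1
            else 0)) :=
    ⟨_, fun _ _ => rfl⟩
  have hDl : ∀ E' : Edge 4 2 → Matrix (Fin N) (Fin N) ℂ,
      Dl E' = H (fun μ x => (u μ : Matrix (Fin N) (Fin N) ℂ) * E' (x, μ))
        (fun μ y => ((u μ : Matrix (Fin N) (Fin N) ℂ) * E' (y, μ))ᴴ) := fun E' => by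
    rw [hDldef, hH]
  have hB0 : B0 = ((m + 4 : ℝ) : ℂ) • (1 : Matrix _ _ ℂ) +
      H (fun μ _ => Complex.exp (↑(θ μ) * I) • (1 : Matrix (Fin N) (Fin N) ℂ))
        (fun μ _ => Complex.exp (-(↑(θ μ) * I)) • (1 : Matrix (Fin N) (Fin N) ℂ)) := by
    rw [hH]
    ext p q
    simp only [hB0def, wilsonDirac, Matrix.of_apply, Matrix.add_apply, Matrix.smul_apply,
      Matrix.one_apply, unitaryFundamentalRep_apply, Matrix.UnitaryGroup.inv_val, hu,
      star_exp_smul_one, Complex.ofReal_one, one_smul, smul_eq_mul, mul_ite, mul_one, mul_zero,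
      sub_eq_add_neg, neg_mul]
  -- the tadpole theorem on this block (all `N`)
  have hT0 : ∀ E : Edge 4 2 → Matrix (Fin N) (Fin N) ℂ,
      (∀ μ : Fin 4, (∑ x : TorusSite 4 2, (E (x, μ)).trace).im = 0) →
        ell E = ∑ μ : Fin 4, ell (fun e => if e = ((0 : TorusSite 4 2), μ) then
          (1 / (N : ℂ)) • (1 : Matrix (Fin N) (Fin N) ℂ) else 0) *
            (∑ x : TorusSite 4 2, (E (x, μ)).trace).re := by
    intro E hE
    simp only [hell]
    exact stub_tadpoleAllN N m θ u hu B0 Dl hB0def hDldef E hE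
  -- the colour multiplier `Λ = ⊕_x λ(x) ⊗ 1_spin`
  obtain ⟨Λ, hΛ⟩ : ∃ Λ : Matrix (TorusSite 4 2 × Fin N × Fin 4) (TorusSite 4 2 × Fin N × Fin 4) ℂ,
      Λ = Matrix.of fun p q : TorusSite 4 2 × Fin N × Fin 4 =>
        if p.1 = q.1 ∧ p.2.2 = q.2.2 then lam p.1 p.2.1 q.2.1 else 0 :=
    ⟨_, rfl⟩
  have hstar : ∀ μ : Fin 4, ((u μ : Matrix (Fin N) (Fin N) ℂ))ᴴ =
      Complex.exp (-(↑(θ μ) * I)) • (1 : Matrix (Fin N) (Fin N) ℂ) := fun μ => by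
    rw [hu, ← Matrix.star_eq_conjTranspose, star_exp_smul_one]
  -- Step 1: `Δ(dλ) = [Λ, B⁰]`
  have h1 : Dl (fun e => lam e.1 - lam (Site.shift e.1 e.2)) = Λ * B0 - B0 * Λ := by
    rw [hDl, hB0, Matrix.mul_add, Matrix.add_mul, Matrix.mul_smul, Matrix.mul_one,
      Matrix.smul_mul, Matrix.one_mul, add_sub_add_left_eq_sub, comm_hop hH hΛ]
    congr 1
    · funext μ x
      simp only [hu, Matrix.smul_mul, Matrix.one_mul, Matrix.mul_smul, Matrix.mul_one, smul_sub]
    · funext μ y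
      simp only [Matrix.conjTranspose_mul, hstar, Matrix.smul_mul, Matrix.one_mul,
        Matrix.mul_smul, Matrix.mul_one, Matrix.conjTranspose_sub, hlam, smul_sub, smul_neg]
      abel
  -- Step 2: `[Λ, Δ(Y)] = Δ(Z)`, `Z(x,μ) = λ(x)Y(x,μ) − Y(x,μ)λ(x+μ̂)`
  have h2 : Λ * Dl Y - Dl Y * Λ = Dl (fun e => lam e.1 * Y e - Y e * lam (Site.shift e.1 e.2)) := by
    rw [hDl, hDl, comm_hop hH hΛ]
    congr 1
    · funext μ x
      simp only [hu, Matrix.smul_mul, Matrix.one_mul, Matrix.mul_smul, smul_sub]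
    · funext μ y
      simp only [Matrix.conjTranspose_mul, hstar, Matrix.smul_mul, Matrix.mul_smul,
        Matrix.mul_one, Matrix.conjTranspose_sub, hY, hlam, smul_sub, Matrix.neg_mul,
        Matrix.mul_neg, neg_neg, smul_neg]
      abel
  -- Step 3: `𝔅(Y, dλ) = ℓ(Z)` by cyclicity
  have h3 : (B0⁻¹ * Dl Y * (B0⁻¹ * Dl (fun e => lam e.1 - lam (Site.shift e.1 e.2)))).trace.re =
      ell (fun e => lam e.1 * Y e - Y e * lam (Site.shift e.1 e.2)) := by
    rw [hell, h1, ← h2, trace_bubble_comm]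
  -- Step 4: ℝ-linearity of `ℓ`
  have hadd : ∀ E₁ E₂ : Edge 4 2 → Matrix (Fin N) (Fin N) ℂ, ell (E₁ + E₂) = ell E₁ + ell E₂ := by
    intro E₁ E₂
    have e1 : (fun μ x => (u μ : Matrix (Fin N) (Fin N) ℂ) * (E₁ + E₂) (x, μ)) =
        (fun μ x => (u μ : Matrix (Fin N) (Fin N) ℂ) * E₁ (x, μ)) +
          fun μ x => (u μ : Matrix (Fin N) (Fin N) ℂ) * E₂ (x, μ) := by
      funext μ x; simp [Matrix.mul_add]
    have e2 : (fun μ y => ((u μ : Matrix (Fin N) (Fin N) ℂ) * (E₁ + E₂) (y, μ))ᴴ) =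
        (fun μ y => ((u μ : Matrix (Fin N) (Fin N) ℂ) * E₁ (y, μ))ᴴ) +
          fun μ y => ((u μ : Matrix (Fin N) (Fin N) ℂ) * E₂ (y, μ))ᴴ := by
      funext μ y; simp [Matrix.mul_add, Matrix.conjTranspose_add]
    rw [hell, hell, hell, hDl, hDl, hDl, e1, e2, hop_add hH, Matrix.mul_add, Matrix.trace_add,
      Complex.add_re]
  have hsmul : ∀ (r : ℝ) (E' : Edge 4 2 → Matrix (Fin N) (Fin N) ℂ),
      ell ((r : ℂ) • E') = r * ell E' := by
    intro r E'
    have e1 : (fun μ x => (u μ : Matrix (Fin N) (Fin N) ℂ) * ((r : ℂ) • E') (x, μ)) =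
        (r : ℂ) • fun μ x => (u μ : Matrix (Fin N) (Fin N) ℂ) * E' (x, μ) := by
      funext μ x; simp
    have e2 : (fun μ y => ((u μ : Matrix (Fin N) (Fin N) ℂ) * ((r : ℂ) • E') (y, μ))ᴴ) =
        (r : ℂ) • fun μ y => ((u μ : Matrix (Fin N) (Fin N) ℂ) * E' (y, μ))ᴴ := by
      funext μ y; simp [Matrix.conjTranspose_smul]
    rw [hell, hell, hDl, hDl, e1, e2, hop_smul hH, Matrix.mul_smul, Matrix.trace_smul, smul_eq_mul,
      Complex.re_ofReal_mul]
  -- Step 5: the commutator field `C(x,μ) = [λ(x) + λ(x+μ̂), Y(x,μ)]` is killed by `ℓ`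
  have hS : ∀ μ : Fin 4, (∑ x : TorusSite 4 2, ((lam x + lam (Site.shift x μ)) * Y (x, μ) -
      Y (x, μ) * (lam x + lam (Site.shift x μ))).trace) = 0 := by
    intro μ
    refine Finset.sum_eq_zero fun x _ => ?_
    rw [Matrix.trace_sub, Matrix.trace_mul_comm, sub_self]
  have him : ∀ μ : Fin 4, (∑ x : TorusSite 4 2, ((lam x + lam (Site.shift x μ)) * Y (x, μ) -
      Y (x, μ) * (lam x + lam (Site.shift x μ))).trace).im = 0 := fun μ => by
    rw [hS μ, Complex.zero_im]
  have hC : ell (fun e => (lam e.1 + lam (Site.shift e.1 e.2)) * Y e -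
      Y e * (lam e.1 + lam (Site.shift e.1 e.2))) = 0 := by
    rw [hT0 (fun e => (lam e.1 + lam (Site.shift e.1 e.2)) * Y e -
        Y e * (lam e.1 + lam (Site.shift e.1 e.2))) him]
    refine Finset.sum_eq_zero fun μ _ => ?_
    rw [hS μ, Complex.zero_re, mul_zero]
  -- Step 6: `2Z = (Y⋆dλ + dλ⋆Y) + C` and assembly
  have hZ : ((2 : ℝ) : ℂ) • (fun e : Edge 4 2 => lam e.1 * Y e - Y e * lam (Site.shift e.1 e.2)) =
      (fun e => Y e * (lam e.1 - lam (Site.shift e.1 e.2)) +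
          (lam e.1 - lam (Site.shift e.1 e.2)) * Y e) +
        fun e => (lam e.1 + lam (Site.shift e.1 e.2)) * Y e -
          Y e * (lam e.1 + lam (Site.shift e.1 e.2)) := by
    funext e
    simp only [Pi.smul_apply, Pi.add_apply, Complex.ofReal_ofNat, two_smul, mul_sub, sub_mul,
      mul_add, add_mul]
    abel
  have key : (2 : ℝ) * ell (fun e => lam e.1 * Y e - Y e * lam (Site.shift e.1 e.2)) =
      ell (fun e => Y e * (lam e.1 - lam (Site.shift e.1 e.2)) +
        (lam e.1 - lam (Site.shift e.1 e.2)) * Y e) := by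
    rw [← hsmul, hZ, hadd, hC, add_zero]
  rw [h3, ← hell]
  exact eq_div_of_mul_eq two_ne_zero ((mul_comm _ _).trans key)

end Summit.QuantumFields.QCD.Cruxes.FlatCellOptimal.WardKernel

end
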